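import Summits.QuantumFields.YangMills.Theorems.EquipartitionCriticalityEquipartitionPinsProbeTangentDefs
import Literature.MathematicalPhysics.QuantumFieldTheory.LatticeAxialGauge
import HarnessLib

/-!
# Comb transport and complete axial gauge on `ℤ⁴`: basic identities

Crux `stmt-QuantumFields-8760` (`EquipartitionPinsProbe`), line `Sketch`, reshaped stub `stub_tangentCore`:
the algebra of the signed straight transport `lineZ`, the comb transport `combTransport` and the
complete axial gauge `axialFix` of the definitions file `…TangentDefs`:

* `lineZ_add_one`, `lineZ_add` — path algebra of straight transports (all signs);
* `combTransport_zero`, `combTransport_add_single` — **Chatterjee's Prop. 9.2 on all of `ℤ⁴`**: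
  `G_U(x + eᵢ) = G_U(x) U(x, i)` across every comb edge `(x, i)` (`x_j = 0` for `j > i`), both signs of `x_i`;
* `axialFix_apply`, `axialFix_of_isComb` (the gauge-fixed configuration is `1` on comb edges),
  `plaquetteHolonomyZd_axialFix` (its plaquette holonomies are conjugates of the original ones);
* `lineZ_congr`, `combTransport_congr` — the comb transport to `x` reads only comb edges in the box
  `‖·‖∞ ≤ ‖x‖∞`.

Reference: S. Chatterjee, arXiv:1602.01222, §9 (Prop. 9.1, 9.2). [arXiv160201222]
-/

noncomputable section

open Literature.Probability.LatticeModels Literature.MathematicalPhysics.QuantumLattice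
open Literature.MathematicalPhysics.QuantumFieldTheory

namespace Summit.QuantumFields.YangMills.Theorems.EquipartitionPinsProbe

namespace CombBasics

variable {d : ℕ} {G : Type} [Group G]

/-! ### Straight transports -/

/-- `lineZ` at a non-negative integer is the forward line. -/
theorem lineZ_ofNat (U : LGConfig d G) (k : Fin d) (n : ℕ) (y : Site d) :
    lineZ U k (n : ℤ) y = ZdGaugeConfig.line U k n y := rfl

/-- `lineZ` at a negative integer is the inverse of the forward line from the endpoint. -/
theorem lineZ_negSucc (U : LGConfig d G) (k : Fin d) (n : ℕ) (y : Site d) :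
    lineZ U k (Int.negSucc n) y = (ZdGaugeConfig.line U k (n + 1) (y - Pi.single k ((n : ℤ) + 1)))⁻¹ := rfl

/-- The empty transport. -/
@[simp] theorem lineZ_zero (U : LGConfig d G) (k : Fin d) (y : Site d) : lineZ U k 0 y = 1 := rfl

/-- The forward line with one step. -/
theorem line_one (U : LGConfig d G) (k : Fin d) (y : Site d) : ZdGaugeConfig.line U k 1 y = U (y, k) := by
  simp [ZdGaugeConfig.line]

/-- Site arithmetic: subtracting a single is adding its negative. -/
theorem sub_single (y : Site d) (k : Fin d) (a : ℤ) : y - Pi.single k a = y + Pi.single k (-a) := by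
  rw [Pi.single_neg, sub_eq_add_neg]

/-- Site arithmetic: two singles in the same direction add up. -/
theorem add_single_add_single (y : Site d) (k : Fin d) (a b : ℤ) :
    y + Pi.single k a + Pi.single k b = y + Pi.single k (a + b) := by
  rw [add_assoc, ← Pi.single_add]

/-- **One more step (all signs)**: `lineZ U k (m + 1) y = lineZ U k m y · U(y + m e_k, k)`. -/
theorem lineZ_add_one (U : LGConfig d G) (k : Fin d) (m : ℤ) (y : Site d) :
    lineZ U k (m + 1) y = lineZ U k m y * U (y + Pi.single k m, k) := by
  rcases m with n | n
  · -- `m = n ≥ 0`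
    have h : (Int.ofNat n : ℤ) + 1 = ((n + 1 : ℕ) : ℤ) := rfl
    rw [h, lineZ_ofNat, show (Int.ofNat n : ℤ) = (n : ℤ) from rfl, lineZ_ofNat,
      AxialGauge.line_succ_right]
  · rcases n with _ | n
    · -- `m = -1`
      have h : Int.negSucc 0 + 1 = (0 : ℤ) := by decide
      rw [h, lineZ_zero, lineZ_negSucc, line_one]
      have hy : y + Pi.single k (Int.negSucc 0) = y - Pi.single k (((0 : ℕ) : ℤ) + 1) := by
        rw [sub_single]; try congr 2
      rw [hy, inv_mul_cancel]
    · -- `m = -(n+2)`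
      have h : Int.negSucc (n + 1) + 1 = Int.negSucc n := rfl
      rw [h, lineZ_negSucc, lineZ_negSucc]
      have hz : y + Pi.single k (Int.negSucc (n + 1)) = y - Pi.single k (((n + 1 : ℕ) : ℤ) + 1) := by
        rw [sub_single]; try congr 2
      rw [hz]
      set z : Site d := y - Pi.single k (((n + 1 : ℕ) : ℤ) + 1) with hzdef
      have hstep : z + Pi.single k 1 = y - Pi.single k ((n : ℤ) + 1) := by
        rw [hzdef, sub_single, sub_single, add_single_add_single]
        congr 2
      rw [show ZdGaugeConfig.line U k (n + 1 + 1) z = U (z, k) * ZdGaugeConfig.line U k (n + 1) (z + Pi.single k 1)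
        from rfl, hstep, mul_inv_rev, inv_mul_cancel_right]

/-- **One step less**: `lineZ U k m y = lineZ U k (m - 1) y · U(y + (m-1) e_k, k)`. -/
theorem lineZ_sub_one (U : LGConfig d G) (k : Fin d) (m : ℤ) (y : Site d) :
    lineZ U k m y = lineZ U k (m - 1) y * U (y + Pi.single k (m - 1), k) := by
  conv_lhs => rw [show m = (m - 1) + 1 by ring]
  exact lineZ_add_one U k (m - 1) y

/-- **Concatenation of straight transports (all signs)**:
`lineZ U k (m + m') y = lineZ U k m y · lineZ U k m' (y + m e_k)`. -/
theorem lineZ_add (U : LGConfig d G) (k : Fin d) (m m' : ℤ) (y : Site d) :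
    lineZ U k (m + m') y = lineZ U k m y * lineZ U k m' (y + Pi.single k m) := by
  induction m' using Int.induction_on with
  | zero => simp
  | succ i ih =>
    rw [← add_assoc, lineZ_add_one, ih, lineZ_add_one, mul_assoc, add_single_add_single]
  | pred i ih =>
    have h1 : m + (-(i : ℤ) - 1) = (m + -(i : ℤ)) - 1 := by ring
    rw [h1]
    have key := lineZ_sub_one U k (m + -(i : ℤ)) y
    have key' := lineZ_sub_one U k (-(i : ℤ)) (y + Pi.single k m)
    rw [ih] at key
    have h2 : m + (-(i : ℤ) - 1) = m + -(i : ℤ) - 1 := by ring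
    rw [add_single_add_single, h2] at key'
    rw [key', ← mul_assoc] at key
    exact (mul_right_cancel key).symm

/-- A straight transport reads only the edges of its segment: if `U` and `U'` agree on the edges
`(y + t e_k, k)` for `|t| ≤ |m|`, the transports by `m` steps from `y` agree. -/
theorem lineZ_congr {U U' : LGConfig d G} (k : Fin d) (m : ℤ) (y : Site d)
    (h : ∀ t : ℤ, |t| ≤ |m| → U (y + Pi.single k t, k) = U' (y + Pi.single k t, k)) :
    lineZ U k m y = lineZ U' k m y := by
  rcases m with n | n
  · rw [show (Int.ofNat n : ℤ) = (n : ℤ) from rfl, lineZ_ofNat, lineZ_ofNat]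
    refine AxialGauge.line_congr k n y fun t ht => h t ?_
    show |((t : ℕ) : ℤ)| ≤ |((n : ℕ) : ℤ)|
    rw [Nat.abs_cast, Nat.abs_cast]; exact_mod_cast ht.le
  · rw [lineZ_negSucc, lineZ_negSucc]
    congr 1
    refine AxialGauge.line_congr k (n + 1) _ fun t ht => ?_
    have e1 : y - Pi.single k ((n : ℤ) + 1) + Pi.single k (t : ℤ) = y + Pi.single k ((t : ℤ) - ((n : ℤ) + 1)) := by
      rw [sub_single, add_single_add_single]; congr 2
    rw [e1]
    refine h _ ?_
    rw [Int.negSucc_eq, abs_neg, abs_of_nonneg (by positivity : (0 : ℤ) ≤ (n : ℤ) + 1), abs_le]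
    constructor <;> linarith [(by exact_mod_cast Nat.lt_succ_iff.mp ht : (t : ℤ) ≤ n)]

/-! ### The comb transport on `ℤ⁴` -/

/-- Unfolding of `combTransport`. -/
theorem combTransport_def (U : LGConfig 4 G) (x : Site 4) :
    combTransport U x = lineZ U 0 (x 0) (truncSite 0 x) * lineZ U 1 (x 1) (truncSite 1 x) *
      lineZ U 2 (x 2) (truncSite 2 x) * lineZ U 3 (x 3) (truncSite 3 x) := rfl

/-- `truncSite k x` has coordinate `j` equal to `x j` below `k` and `0` from `k` on. -/
@[simp] theorem truncSite_apply (k : Fin d) (x : Site d) (j : Fin d) :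
    truncSite k x j = if j < k then x j else 0 := rfl

/-- The comb transport to the origin is trivial. -/
@[simp] theorem combTransport_zero (U : LGConfig 4 G) : combTransport U 0 = 1 := by
  simp [combTransport_def]

/-- Truncation ignores changes in coordinates `≥ k`. -/
theorem truncSite_add_single_of_le {k i : Fin d} (hki : k ≤ i) (x : Site d) (c : ℤ) :
    truncSite k (x + Pi.single i c) = truncSite k x := by
  ext j
  simp only [truncSite_apply, Pi.add_apply]
  split_ifs with hj
  · rw [Pi.single_eq_of_ne (ne_of_lt (lt_of_lt_of_le hj hki)), add_zero]
  · rfl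

/-- For a comb edge `(x, i)`: the `i`-th leg starts at `truncSite i x` and `truncSite i x + x_i eᵢ = x`. -/
theorem truncSite_add_single_self {x : Site d} {i : Fin d} (hc : ∀ j : Fin d, i < j → x j = 0) :
    truncSite i x + Pi.single i (x i) = x := by
  ext j
  simp only [truncSite_apply, Pi.add_apply]
  rcases lt_trichotomy j i with hj | rfl | hj
  · simp [hj, Pi.single_eq_of_ne (ne_of_lt hj)]
  · simp
  · rw [if_neg (not_lt.2 hj.le), Pi.single_eq_of_ne (ne_of_gt hj), zero_add]
    exact (hc j hj).symm

/-- Bookkeeping for a four-fold product in which one factor gains a right factor `u`, the factors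
before it are unchanged and the factors after it are trivial. -/
theorem prod_four_update (f f' : Fin 4 → G) (i : Fin 4) (u : G)
    (hlt : ∀ k : Fin 4, k < i → f' k = f k) (heq : f' i = f i * u)
    (hgt : ∀ k : Fin 4, i < k → f' k = 1 ∧ f k = 1) :
    f' 0 * f' 1 * f' 2 * f' 3 = f 0 * f 1 * f 2 * f 3 * u := by
  fin_cases i
  · obtain ⟨a1, b1⟩ := hgt 1 (by decide); obtain ⟨a2, b2⟩ := hgt 2 (by decide); obtain ⟨a3, b3⟩ := hgt 3 (by decide)
    simp only [Fin.zero_eta] at heq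
    rw [heq, a1, b1, a2, b2, a3, b3]; group
  · obtain ⟨a2, b2⟩ := hgt 2 (by decide); obtain ⟨a3, b3⟩ := hgt 3 (by decide)
    have c0 := hlt 0 (by decide)
    simp only [Fin.mk_one] at heq
    rw [heq, c0, a2, b2, a3, b3]; group
  · obtain ⟨a3, b3⟩ := hgt 3 (by decide)
    have c0 := hlt 0 (by decide); have c1 := hlt 1 (by decide)
    simp only [Fin.reduceFinMk] at heq
    rw [heq, c0, c1, a3, b3]; group
  · have c0 := hlt 0 (by decide); have c1 := hlt 1 (by decide); have c2 := hlt 2 (by decide)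
    simp only [Fin.reduceFinMk] at heq
    rw [heq, c0, c1, c2]; group

/-- **Prop. 9.2 on `ℤ⁴` (all signs)**: across a comb edge `(x, i)` (`x_j = 0` for `j > i`),
`G_U(x + eᵢ) = G_U(x) · U(x, i)`. -/
theorem combTransport_add_single (U : LGConfig 4 G) {x : Site 4} {i : Fin 4}
    (hc : ∀ j : Fin 4, i < j → x j = 0) :
    combTransport U (x + Pi.single i 1) = combTransport U x * U (x, i) := by
  rw [combTransport_def, combTransport_def]
  refine prod_four_update (fun k => lineZ U k (x k) (truncSite k x))
    (fun k => lineZ U k ((x + Pi.single i 1 : Site 4) k) (truncSite k (x + Pi.single i 1))) i (U (x, i))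
    (fun k hk => ?_) ?_ (fun k hk => ?_)
  · -- legs below `i` are unchanged
    rw [truncSite_add_single_of_le hk.le, Pi.add_apply, Pi.single_eq_of_ne (ne_of_lt hk), add_zero]
  · -- the `i`-th leg gains one step ending at `x`
    rw [truncSite_add_single_of_le le_rfl, Pi.add_apply, Pi.single_eq_same, lineZ_add_one,
      truncSite_add_single_self hc]
  · -- legs above `i` are trivial
    rw [Pi.add_apply, Pi.single_eq_of_ne (ne_of_gt hk), add_zero, hc k hk]
    exact ⟨lineZ_zero _ _ _, lineZ_zero _ _ _⟩

/-! ### The complete axial gauge -/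

/-- Unfolding of `axialFix`: `Ũ(y, j) = G_U(y) U(y, j) G_U(y + e_j)⁻¹`. -/
theorem axialFix_apply (U : LGConfig 4 G) (e : Literature.MathematicalPhysics.QuantumLattice.ZdEdge 4) :
    axialFix U e = combTransport U e.1 * U e * (combTransport U (e.1 + Pi.single e.2 1))⁻¹ := rfl

/-- **The gauge-fixed configuration is trivial on comb edges.** -/
theorem axialFix_of_isComb (U : LGConfig 4 G) {y : Site 4} {j : Fin 4} (hc : ∀ j' : Fin 4, j < j' → y j' = 0) :
    axialFix U (y, j) = 1 := by
  rw [axialFix_apply, combTransport_add_single U hc, mul_inv_rev, ← mul_assoc, mul_inv_cancel_right,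
    mul_inv_cancel]

/-- **Plaquette holonomies of the gauge-fixed configuration are conjugates**:
`Ũ_p = G_U(x) U_p G_U(x)⁻¹` for the plaquette `p` based at `x`. -/
theorem plaquetteHolonomyZd_axialFix (U : LGConfig 4 G) (x : Site 4) (i j : Fin 4) :
    plaquetteHolonomyZd (axialFix U) x i j = combTransport U x * plaquetteHolonomyZd U x i j * (combTransport U x)⁻¹ :=
  plaquetteHolonomyZd_gaugeTransformZd _ _ _ _ _

/-! ### Locality: the comb transport reads only comb edges in a box -/

/-- An edge read by the `k`-th leg of the comb path to `x` is a comb edge with coordinates bounded by those of `x`. -/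
theorem leg_edge_isComb_and_bound (x : Site 4) (k : Fin 4) (t : ℤ) (ht : |t| ≤ |x k|) :
    (∀ j : Fin 4, k < j → (truncSite k x + Pi.single k t : Site 4) j = 0) ∧
      ∀ j : Fin 4, |(truncSite k x + Pi.single k t : Site 4) j| ≤ |x j| := by
  constructor
  · intro j hj
    rw [Pi.add_apply, truncSite_apply, if_neg (not_lt.2 hj.le), Pi.single_eq_of_ne (ne_of_gt hj), add_zero]
  · intro j
    rw [Pi.add_apply, truncSite_apply]
    rcases lt_trichotomy j k with hj | rfl | hj
    · rw [if_pos hj, Pi.single_eq_of_ne (ne_of_lt hj), add_zero]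
    · rw [if_neg (lt_irrefl _), Pi.single_eq_same, zero_add]; exact ht
    · rw [if_neg (not_lt.2 hj.le), Pi.single_eq_of_ne (ne_of_gt hj), add_zero, abs_zero]; exact abs_nonneg _

/-- **Locality of the comb transport**: if `U` and `U'` agree on every comb edge `(z, k)` with
`|z_j| ≤ |x_j|` for all `j`, then `G_U(x) = G_{U'}(x)`. -/
theorem combTransport_congr {U U' : LGConfig 4 G} (x : Site 4)
    (h : ∀ (z : Site 4) (k : Fin 4), (∀ j : Fin 4, k < j → z j = 0) → (∀ j : Fin 4, |z j| ≤ |x j|) →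
      U (z, k) = U' (z, k)) :
    combTransport U x = combTransport U' x := by
  have leg : ∀ k : Fin 4, lineZ U k (x k) (truncSite k x) = lineZ U' k (x k) (truncSite k x) := fun k =>
    lineZ_congr k (x k) _ fun t ht =>
      h _ k (leg_edge_isComb_and_bound x k t ht).1 (leg_edge_isComb_and_bound x k t ht).2
  rw [combTransport_def, combTransport_def, leg 0, leg 1, leg 2, leg 3]

/-- In particular the comb transport does not read non-comb edges: updating `U` on an edge `(z, k)`
with `z_j ≠ 0` for some `j > k` changes no `G_U(x)`. -/
theorem combTransport_update_of_not_isComb (U : LGConfig 4 G) {e : Literature.MathematicalPhysics.QuantumLattice.ZdEdge 4}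
    (he : ¬ ∀ j : Fin 4, e.2 < j → e.1 j = 0) (g : G) (x : Site 4) :
    combTransport (Function.update U e g) x = combTransport U x :=
  combTransport_congr x fun z k hzk _ => by
    rw [Function.update_of_ne]
    rintro rfl
    exact he hzk

end CombBasics

/-- STUB TC1 of line `Sketch` (crux `stmt-QuantumFields-8760`) — **comb basics**: Prop. 9.2 on `ℤ⁴`,
triviality of the gauge-fixed configuration on comb edges, conjugation of plaquette holonomies, and
invisibility of non-comb links to the comb transport. -/
theorem stub_combBasics :
    ∀ (G : Type) [Group G] (U : Literature.MathematicalPhysics.QuantumLattice.LGConfig 4 G),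
      (∀ (x : Literature.Probability.LatticeModels.Site 4) (i : Fin 4), (∀ j : Fin 4, i < j → x j = 0) →
        Summit.QuantumFields.YangMills.Theorems.EquipartitionPinsProbe.combTransport U (x + Pi.single i 1) = Summit.QuantumFields.YangMills.Theorems.EquipartitionPinsProbe.combTransport U x * U (x, i)) ∧
      (∀ (y : Literature.Probability.LatticeModels.Site 4) (j : Fin 4), (∀ j' : Fin 4, j < j' → y j' = 0) → Summit.QuantumFields.YangMills.Theorems.EquipartitionPinsProbe.axialFix U (y, j) = 1) ∧
      (∀ (x : Literature.Probability.LatticeModels.Site 4) (i j : Fin 4), Literature.MathematicalPhysics.QuantumLattice.plaquetteHolonomyZd (Summit.QuantumFields.YangMills.Theorems.EquipartitionPinsProbe.axialFix U) x i j =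
        Summit.QuantumFields.YangMills.Theorems.EquipartitionPinsProbe.combTransport U x * Literature.MathematicalPhysics.QuantumLattice.plaquetteHolonomyZd U x i j * (Summit.QuantumFields.YangMills.Theorems.EquipartitionPinsProbe.combTransport U x)⁻¹) ∧
      (∀ (e : Literature.MathematicalPhysics.QuantumLattice.ZdEdge 4), (¬ ∀ j : Fin 4, e.2 < j → e.1 j = 0) → ∀ (g : G) (x : Literature.Probability.LatticeModels.Site 4),
        Summit.QuantumFields.YangMills.Theorems.EquipartitionPinsProbe.combTransport (Function.update U e g) x = Summit.QuantumFields.YangMills.Theorems.EquipartitionPinsProbe.combTransport U x) := by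
  intro G _ U
  exact ⟨fun x i hc => CombBasics.combTransport_add_single U hc,
    fun y j hc => CombBasics.axialFix_of_isComb U hc,
    fun x i j => CombBasics.plaquetteHolonomyZd_axialFix U x i j,
    fun e he g x => CombBasics.combTransport_update_of_not_isComb U he g x⟩

end Summit.QuantumFields.YangMills.Theorems.EquipartitionPinsProbe

end
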